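import Mathlib.AlgebraicGeometry.Morphisms.Etale
import Mathlib.AlgebraicGeometry.Morphisms.Finite
import Mathlib.AlgebraicGeometry.Morphisms.FlatMono
import Mathlib.AlgebraicGeometry.Gluing
import Mathlib.AlgebraicGeometry.Limits
import Mathlib.FieldTheory.IsAlgClosed.AlgebraicClosure
import Literature.AlgebraicGeometry.Morphisms.SectionEqualizerClopen
import HarnessLib

/-!
# A finite étale closed subscheme of a SPLIT finite étale scheme is split on a subfamily of the sections

Topic `Literature/AlgebraicGeometry/Morphisms`, namespace `Literature.AlgebraicGeometry.Morphisms`.  THEOREMS ONLY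
(no definition, no named fact, no instance, no notation, no `sorry`).  Cell `hodgecm-mathlib` (D-0151), FLOOR-0 programme
P1, F-3 child line (M) `Cruxes/HDel/Lines/F3DualAbelianSchemeM`, letter (Ma) «split the finite étale `K(L)` over the
level-`m`-basis cover» (B-typ04 (g15) letters d823bfca §2; B-plan1 (g19) (M)-card v1): the two generic «∅» inputs of its proof
road — «a clopen sub(group)scheme of a constant finite étale scheme over a connected base is constant» and the local-on-`T`
description of the `T`-points of a split scheme — stated scheme-theoretically.  Author B-p19 (g18); count-neutral capital.
HC_CM is proved only modulo the 7 printed citations until rung 0 closes; nothing in this file is about HC.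

## Setting and sources

`q : F ⟶ S` is SPLIT by a finite family of sections `φ a : S ⟶ F` (`a : ι`): every GEOMETRIC point of `F` is the value of
some `φ a` ([GortzWedhorn2023] Def. 18.34 / Prop. 18.24: a scheme locally of finite type over a field is unramified iff it becomes `∐ Spec K` over an algebraically closed `K`;
[SGA1] Exp. V / [GortzWedhorn2023] Prop. 27.188 (1): `X[n]` is étale-locally the constant group `(ℤ/n)^{2g}` — over the
level-`n`-basis cover it is split by the `n^{2g}` sections `Σ aᵢ φᵢ`).  For `q` unramified, locally of finite type and
separated (e.g. finite étale) the equaliser of two sections is OPEN AND CLOSED ([GortzWedhorn2020] Prop. 9.3/9.5, Def./Prop.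
9.7; [GortzWedhorn2023] Rem. 18.30; tree ★ `Morphisms/SectionEqualizerClopen`).  Consequences proved here:

* §1 `isOpenImmersion_of_isClosedImmersion_of_etale` — a closed immersion `j : Z ⟶ F` over `S` with `Z → S` étale and
  `F → S` unramified is ALSO an open immersion (Mathlib `Etale.of_comp`: `j` is étale; an étale monomorphism is an open
  immersion, Mathlib `IsOpenImmersion.of_flat_of_mono` [Stacks 06NC/025G]); its range is clopen
  (`isClopen_range_of_isClosedImmersion_of_etale`).  [GortzWedhorn2023] Remark 18.36, Rem. 18.30.
* §2 `exists_fac_of_apply_mem_range` — over a PRECONNECTED test scheme, a morphism that meets the clopen range of such a `j`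
  factors through `j` (clopen + connected + Mathlib `IsOpenImmersion.lift`).
* §3 `exists_openCover_comp_eq_section` — **`T`-points of a split scheme, local form**: for ANY `T` and `x : T ⟶ F` over
  `g : T ⟶ S` there is an open cover of `T` on each member of which `x = g ≫ φ a` for some `a` (the members are the clopen
  equalisers `Eq(x, (g ≫ φ a))` of sections of `F_T → T`; they cover `T` because they cover its geometric points);
  `exists_comp_eq_section_of_preconnectedSpace` — the global form over a preconnected nonempty `T`.
* §4 `exists_fac_iff_exists_openCover_of_split` — **the clopen subscheme `Z` is split on the subfamily
  `I_Z = {a | φ a factors through j}`** (base `S` preconnected): a `T`-point `x` of `F` factors through `Z` iff, locally on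
  `T`, `x = g ≫ φ a` with `a ∈ I_Z`.  This is the shape of the membership clause of letter (Ma) (`K(L′)` = the constant
  subgroup scheme on a finite subgroup `K′` of sections), with `x := u.left`, `g := T.hom`.
* §4 `exists_fac_iff_exists_openCover_of_split_on_opens` — the same relative to a preconnected OPEN `U ⊆ S` (for
  `T`-points over `U`; no connectedness of `S`), the form used on the connected components of a disconnected base.
* §5 `exists_glue_of_isCompl` / `exists_section_glue_of_isCompl` — gluing two morphisms (two sections of `q`) along a
  clopen decomposition `S = U ⊔ U'`; `exists_glue_of_pairwise_disjoint` / `exists_section_glue_of_pairwise_disjoint` —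
  the same along an arbitrary clopen PARTITION; `exists_glue_local_of_pairwise_disjoint` — local data `U k ⟶ Y` (Mathlib `Scheme.Cover.glueMorphisms` on the two-member open cover; the overlap is
  empty) — used by the (Ma) prover to extend a section given on one connected component by the unit section elsewhere,
  since the level-basis cover `S′` of (Ma0) is not connected.

## References
* [GortzWedhorn2020] U. Görtz, T. Wedhorn, *Algebraic Geometry I*, 2nd ed. (2020), Prop. 9.3, Prop. 9.5, Def./Prop. 9.7,
  Example 9.12; Prop. 3.24 (gluing of morphisms).
* [GortzWedhorn2023] U. Görtz, T. Wedhorn, *Algebraic Geometry II* (2023), Def. 18.34, Remark 18.36, Prop. 18.24, Remark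
  18.30; Prop. 27.188 (1) (p. 675).
* [MumfordFogartyKirwan1994] D. Mumford, J. Fogarty, F. Kirwan, *Geometric Invariant Theory*, 3rd ed. (1994), Ch. 7 §2
  Prop. 7.3, proof, step (IV) (pp. 133–134).
-/

noncomputable section

open CategoryTheory CategoryTheory.Limits AlgebraicGeometry

universe u

namespace Literature.AlgebraicGeometry.Morphisms

/-! ## §1 A closed immersion between finite étale `S`-schemes is an open immersion with clopen range -/

section ClosedOpen

variable {Z F S : Scheme.{u}} (j : Z ⟶ F) (q : F ⟶ S)

/-- **A closed immersion `j : Z ⟶ F` over `S` with `Z → S` étale and `F → S` unramified (locally of finite type) is an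
open immersion**: `j` is étale (Mathlib `Etale.of_comp`), hence flat and locally of finite presentation, and a flat
monomorphism locally of finite presentation is an open immersion (Mathlib `IsOpenImmersion.of_flat_of_mono`).
[cite: GortzWedhorn2023, Remark 18.36 and Remark 18.30] -/
theorem isOpenImmersion_of_isClosedImmersion_of_etale [IsClosedImmersion j] [LocallyOfFiniteType q]
    [FormallyUnramified q] {qZ : Z ⟶ S} [Etale qZ] (w : j ≫ q = qZ) : IsOpenImmersion j := by
  haveI : Etale (j ≫ q) := by rw [w]; infer_instance
  haveI : Etale j := Etale.of_comp j q
  exact IsOpenImmersion.of_flat_of_mono j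

/-- The range of such a `j` is open and closed in `F`. [cite: GortzWedhorn2023, Remark 18.36 and Remark 18.30]
[cite: GortzWedhorn2020, Example 9.12] -/
theorem isClopen_range_of_isClosedImmersion_of_etale [IsClosedImmersion j] [LocallyOfFiniteType q]
    [FormallyUnramified q] {qZ : Z ⟶ S} [Etale qZ] (w : j ≫ q = qZ) : IsClopen (Set.range j) := by
  haveI := isOpenImmersion_of_isClosedImmersion_of_etale j q w
  exact ⟨j.isClosedEmbedding.isClosed_range, j.isOpenEmbedding.isOpen_range⟩

end ClosedOpen

/-! ## §2 Over a preconnected test scheme: meet the clopen subscheme ⇒ factor through it -/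

section Factor

variable {Z F : Scheme.{u}} (j : Z ⟶ F)

/-- **A morphism from a PRECONNECTED scheme that meets a clopen open subscheme factors through it**: if `j` is an open
immersion with closed range and `x : T ⟶ F` hits `range j` at one point, then `x⁻¹(range j)` is a nonempty clopen subset
of the preconnected `T`, hence everything, and `x` lifts along `j` (Mathlib `IsOpenImmersion.lift`).
[cite: GortzWedhorn2020, Def./Prop. 9.7] -/
theorem exists_fac_of_apply_mem_range [IsOpenImmersion j] (hcl : IsClosed (Set.range j)) {T : Scheme.{u}}
    [PreconnectedSpace T] (x : T ⟶ F) {t : T} (ht : x t ∈ Set.range j) : ∃ z : T ⟶ Z, z ≫ j = x := by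
  have hpre : IsClopen (x ⁻¹' Set.range j) :=
    ⟨hcl.preimage x.continuous, j.isOpenEmbedding.isOpen_range.preimage x.continuous⟩
  have huniv : x ⁻¹' Set.range j = Set.univ :=
    (isClopen_iff.mp hpre).resolve_left (Set.nonempty_of_mem (s := x ⁻¹' Set.range j) ht).ne_empty
  refine ⟨IsOpenImmersion.lift j x ?_, IsOpenImmersion.lift_fac _ _ _⟩
  rintro _ ⟨t', rfl⟩
  exact (Set.eq_univ_iff_forall.mp huniv) t'

/-- Contrapositive bookkeeping: over a preconnected `T`, either `x` factors through `j` or `x` misses `range j` entirely.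
[cite: GortzWedhorn2020, Def./Prop. 9.7] -/
theorem exists_fac_or_disjoint [IsOpenImmersion j] (hcl : IsClosed (Set.range j)) {T : Scheme.{u}}
    [PreconnectedSpace T] (x : T ⟶ F) : (∃ z : T ⟶ Z, z ≫ j = x) ∨ Disjoint (Set.range x) (Set.range j) := by
  by_cases h : ∃ t, x t ∈ Set.range j
  · obtain ⟨t, ht⟩ := h
    exact Or.inl (exists_fac_of_apply_mem_range j hcl x ht)
  · refine Or.inr (Set.disjoint_left.mpr ?_)
    rintro _ ⟨t, rfl⟩ hmem
    exact h ⟨t, hmem⟩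

end Factor

/-! ## §3 `T`-points of a split scheme: locally on `T` they are values of the splitting sections -/

section Split

variable {F S : Scheme.{u}} (q : F ⟶ S) {ι : Type*} (φ : ι → (S ⟶ F)) (hφ : ∀ a, φ a ≫ q = 𝟙 S)

/-- The equaliser test for «`x = g ≫ φ a` after `y`»: with the two sections `(x, 1)` and `(g ≫ φ a, 1)` of
`F_T = F ×_S T → T`, a test morphism `y : T' ⟶ T` satisfies `y ≫ x = y ≫ g ≫ φ a` iff it lands in their (open)
equaliser ([GortzWedhorn2020] Prop. 9.3/9.5 via ★ `comp_eq_comp_iff_range_subset_sectionEqualizer`).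
[cite: GortzWedhorn2020, Prop. 9.3 and Prop. 9.5] -/
theorem comp_eq_comp_section_iff_range_subset [FormallyUnramified q] [LocallyOfFiniteType q]
    {T : Scheme.{u}} (x : T ⟶ F) (g : T ⟶ S) (w : x ≫ q = g) (a : ι)
    (wx : pullback.lift x (𝟙 T) (by rw [w, Category.id_comp]) ≫ pullback.snd q g =
      pullback.lift (g ≫ φ a) (𝟙 T) (by rw [Category.assoc, hφ, Category.comp_id, Category.id_comp]) ≫
        pullback.snd q g)
    {T' : Scheme.{u}} (y : T' ⟶ T) :
    y ≫ x = y ≫ g ≫ φ a ↔ Set.range y ⊆ Set.range (pullback.snd (pullback.diagonal (pullback.snd q g))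
      (pullback.lift (pullback.lift x (𝟙 T) (by rw [w, Category.id_comp]))
        (pullback.lift (g ≫ φ a) (𝟙 T) (by rw [Category.assoc, hφ, Category.comp_id, Category.id_comp])) wx)) := by
  haveI : FormallyUnramified (pullback.snd q g) :=
    MorphismProperty.pullback_snd (P := @FormallyUnramified) q g inferInstance
  haveI : LocallyOfFiniteType (pullback.snd q g) :=
    MorphismProperty.pullback_snd (P := @LocallyOfFiniteType) q g inferInstance
  rw [← comp_eq_comp_iff_range_subset_sectionEqualizer wx y]
  constructor
  · intro h
    apply pullback.hom_ext
    · simpa only [Category.assoc, pullback.lift_fst] using h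
    · simp only [Category.assoc, pullback.lift_snd]
  · intro h
    have h' := congrArg (· ≫ pullback.fst q g) h
    simpa only [Category.assoc, pullback.lift_fst] using h'

variable (hsplit : ∀ ⦃Ω : Type u⦄ [Field Ω] [IsAlgClosed Ω] (y : Spec (.of Ω) ⟶ F), ∃ a, y = (y ≫ q) ≫ φ a)

include hφ hsplit

/-- **`T`-points of a split scheme, pointwise-local form.**  Let `q : F → S` be unramified, locally of finite type and
separated, split by the sections `φ a` (every geometric point of `F` is a value of some `φ a`).  Then for every
`x : T ⟶ F` over `g : T ⟶ S` and every `t ∈ T` there are an open `U ∋ t` and an index `a` with `x = g ≫ φ a` on `U`: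
`U` is the equaliser `Eq((x,1), (g ≫ φ a, 1))` of sections of `F_T → T` — open (and closed) by [GortzWedhorn2023] Rem. 18.30
— for the `a` with `x(t̄) = φ a (g t̄)` at a geometric point `t̄` over `t`. [cite: GortzWedhorn2023, Remark 18.30 and Prop. 18.29]
[cite: GortzWedhorn2020, Prop. 9.3 and Prop. 9.5] [cite: GortzWedhorn2023, Prop. 18.24] -/
theorem exists_opens_comp_eq_section [FormallyUnramified q] [LocallyOfFiniteType q] [IsSeparated q]
    {T : Scheme.{u}} (x : T ⟶ F) (g : T ⟶ S) (w : x ≫ q = g) (t : T) :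
    ∃ (U : T.Opens) (a : ι), t ∈ U ∧ U.ι ≫ x = U.ι ≫ g ≫ φ a := by
  classical
  haveI : FormallyUnramified (pullback.snd q g) :=
    MorphismProperty.pullback_snd (P := @FormallyUnramified) q g inferInstance
  haveI : LocallyOfFiniteType (pullback.snd q g) :=
    MorphismProperty.pullback_snd (P := @LocallyOfFiniteType) q g inferInstance
  let σx : T ⟶ pullback q g := pullback.lift x (𝟙 T) (by rw [w, Category.id_comp])
  let σ : ι → (T ⟶ pullback q g) := fun a =>
    pullback.lift (g ≫ φ a) (𝟙 T) (by rw [Category.assoc, hφ, Category.comp_id, Category.id_comp])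
  have hw : ∀ a, σx ≫ pullback.snd q g = σ a ≫ pullback.snd q g := fun a => by
    simp only [σx, σ, pullback.lift_snd]
  -- the equalisers `E a ⊆ T`, open
  let E : ι → T.Opens := fun a =>
    ⟨Set.range (pullback.snd (pullback.diagonal (pullback.snd q g)) (pullback.lift σx (σ a) (hw a))),
      (pullback.snd (pullback.diagonal (pullback.snd q g)) (pullback.lift σx (σ a) (hw a))).isOpenEmbedding.isOpen_range⟩
  have hiff : ∀ (a) {T' : Scheme.{u}} (y : T' ⟶ T), y ≫ x = y ≫ g ≫ φ a ↔ Set.range y ⊆ (E a : Set T) :=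
    fun a T' y => comp_eq_comp_section_iff_range_subset q φ hφ x g w a (hw a) y
  -- a geometric point over `t` lands in some `E a`
  let κ := T.residueField t
  let Ω := AlgebraicClosure κ
  let tbar : Spec (.of Ω) ⟶ T := Spec.map (CommRingCat.ofHom (algebraMap κ Ω)) ≫ T.fromSpecResidueField t
  have htbar : ∀ p, tbar p = t := fun p => by
    simp only [tbar, Scheme.Hom.comp_apply]
    exact Scheme.fromSpecResidueField_apply t _
  obtain ⟨a, ha⟩ := hsplit (tbar ≫ x)
  have hmem : Set.range tbar ⊆ (E a : Set T) := by
    rw [← hiff a tbar, ha, Category.assoc, Category.assoc, ← Category.assoc x q (φ a), w]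
  refine ⟨E a, a, ?_, ?_⟩
  · rw [← htbar (IsLocalRing.closedPoint Ω)]
    exact hmem ⟨_, rfl⟩
  · rw [hiff]
    rintro _ ⟨s, rfl⟩
    rw [Scheme.Opens.ι_apply]
    exact s.2

/-- **`T`-points of a split scheme, open-cover form**: an open cover of `T` on each member of which `x = g ≫ φ a` for a
single `a` (members through every point, by `exists_opens_comp_eq_section`). [cite: GortzWedhorn2020, Prop. 9.3 and Prop. 9.5]
[cite: GortzWedhorn2023, Remark 18.30 and Prop. 18.29] -/
theorem exists_openCover_comp_eq_section [FormallyUnramified q] [LocallyOfFiniteType q] [IsSeparated q]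
    {T : Scheme.{u}} (x : T ⟶ F) (g : T ⟶ S) (w : x ≫ q = g) :
    ∃ 𝒱 : Scheme.OpenCover.{u} T, ∀ i, ∃ a, 𝒱.f i ≫ x = 𝒱.f i ≫ g ≫ φ a := by
  choose U a hmem hU using exists_opens_comp_eq_section q φ hφ hsplit x g w
  have hcov : TopologicalSpace.IsOpenCover U := by
    refine TopologicalSpace.IsOpenCover.mk (top_le_iff.mp fun t _ => ?_)
    exact TopologicalSpace.Opens.mem_iSup.mpr ⟨t, hmem t⟩
  exact ⟨T.openCoverOfIsOpenCover U hcov, fun t => ⟨a t, hU t⟩⟩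

/-- **`T`-points of a split scheme over a PRECONNECTED nonempty `T` are global values of ONE splitting section** (the
clopen equaliser through a point is everything). [cite: GortzWedhorn2020, Def./Prop. 9.7]
[cite: GortzWedhorn2023, Remark 18.30 and Prop. 18.29] -/
theorem exists_comp_eq_section_of_preconnectedSpace [FormallyUnramified q] [LocallyOfFiniteType q] [IsSeparated q]
    {T : Scheme.{u}} [PreconnectedSpace T] [Nonempty T] (x : T ⟶ F) (g : T ⟶ S) (w : x ≫ q = g) :
    ∃ a, x = g ≫ φ a := by
  classical
  obtain ⟨t⟩ := ‹Nonempty T›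
  obtain ⟨U, a, htU, hU⟩ := exists_opens_comp_eq_section q φ hφ hsplit x g w t
  refine ⟨a, ?_⟩
  haveI : FormallyUnramified (pullback.snd q g) :=
    MorphismProperty.pullback_snd (P := @FormallyUnramified) q g inferInstance
  haveI : LocallyOfFiniteType (pullback.snd q g) :=
    MorphismProperty.pullback_snd (P := @LocallyOfFiniteType) q g inferInstance
  haveI : IsSeparated (pullback.snd q g) :=
    MorphismProperty.pullback_snd (P := @IsSeparated) q g inferInstance
  let σx : T ⟶ pullback q g := pullback.lift x (𝟙 T) (by rw [w, Category.id_comp])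
  let σa : T ⟶ pullback q g :=
    pullback.lift (g ≫ φ a) (𝟙 T) (by rw [Category.assoc, hφ, Category.comp_id, Category.id_comp])
  have hw : σx ≫ pullback.snd q g = σa ≫ pullback.snd q g := by simp only [σx, σa, pullback.lift_snd]
  have hiff : ∀ {T' : Scheme.{u}} (y : T' ⟶ T), y ≫ x = y ≫ g ≫ φ a ↔
      Set.range y ⊆ Set.range (pullback.snd (pullback.diagonal (pullback.snd q g)) (pullback.lift σx σa hw)) :=
    fun y => comp_eq_comp_section_iff_range_subset q φ hφ x g w a hw y
  have hE : IsClopen (Set.range (pullback.snd (pullback.diagonal (pullback.snd q g)) (pullback.lift σx σa hw))) :=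
    isClopen_range_sectionEqualizer hw
  have hne : (Set.range (pullback.snd (pullback.diagonal (pullback.snd q g)) (pullback.lift σx σa hw))).Nonempty :=
    ⟨t, (hiff U.ι).mp hU ⟨⟨t, htU⟩, U.ι_apply _⟩⟩
  have huniv := (isClopen_iff.mp hE).resolve_left hne.ne_empty
  have h1 : 𝟙 T ≫ x = 𝟙 T ≫ g ≫ φ a := by
    rw [hiff (𝟙 T), huniv]
    exact Set.subset_univ _
  simpa only [Category.id_comp] using h1

end Split

/-! ## §4 The clopen subscheme `Z ⊆ F` is split on the subfamily `I_Z = {a | φ a factors through Z}` -/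

section SubschemeOfSplit

variable {Z F S : Scheme.{u}} (j : Z ⟶ F) (q : F ⟶ S) {ι : Type*} (φ : ι → (S ⟶ F)) (hφ : ∀ a, φ a ≫ q = 𝟙 S)
  (hsplit : ∀ ⦃Ω : Type u⦄ [Field Ω] [IsAlgClosed Ω] (y : Spec (.of Ω) ⟶ F), ∃ a, y = (y ≫ q) ≫ φ a)

include hφ hsplit

/-- **A finite étale closed subscheme of a split finite étale scheme over a CONNECTED base is split on a subfamily of the
sections.**  Let `q : F → S` be unramified, locally of finite type and separated, split by the sections `φ a`, let
`j : Z ⟶ F` be a closed immersion with `Z → S` étale (so `j` is also an open immersion, §1), and let `S` be preconnected.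
Put `I_Z := {a | φ a factors through j}`.  Then a `T`-point `x : T ⟶ F` (over `g : T ⟶ S`, ANY `T`) factors through `Z`
iff there is an open cover of `T` on each member of which `x = g ≫ φ a` for some `a ∈ I_Z` — i.e. `Z` «is» the constant
subscheme on `I_Z`.  (⇒: §3 gives, through each `t ∈ T`, an open member with `x = g ≫ φ a` on it; then `φ a (g t) = x t`
lies in `range j`, so `φ a` meets `Z` and factors through it by §2 applied on the preconnected `S`.  ⇐: locally `x` lands
in the clopen `range j`, hence globally, and lifts along the open immersion `j`.)  This is the generic content of «`K(L)`
pulled back to the level-basis cover is the constant subgroup scheme on a finite subgroup of sections»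
([MumfordFogartyKirwan1994] Ch. 7 §2 Prop. 7.3 step (IV); [GortzWedhorn2023] Prop. 27.188 (1)).
[cite: GortzWedhorn2023, Prop. 27.188 (1) (p. 675)] [cite: MumfordFogartyKirwan1994, Ch. 7 §2 Proposition 7.3, proof step (IV) (pp. 133–134)]
[cite: GortzWedhorn2020, Def./Prop. 9.7] -/
theorem exists_fac_iff_exists_openCover_of_split [FormallyUnramified q] [LocallyOfFiniteType q] [IsSeparated q]
    [IsClosedImmersion j] {qZ : Z ⟶ S} [Etale qZ] (wZ : j ≫ q = qZ) [PreconnectedSpace S]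
    {T : Scheme.{u}} (x : T ⟶ F) (g : T ⟶ S) (w : x ≫ q = g) :
    (∃ z : T ⟶ Z, z ≫ j = x) ↔
      ∃ 𝒱 : Scheme.OpenCover.{u} T, ∀ i, ∃ a, (∃ ψ : S ⟶ Z, ψ ≫ j = φ a) ∧ 𝒱.f i ≫ x = 𝒱.f i ≫ g ≫ φ a := by
  haveI := isOpenImmersion_of_isClosedImmersion_of_etale j q wZ
  have hcl : IsClosed (Set.range j) := j.isClosedEmbedding.isClosed_range
  constructor
  · rintro ⟨z, rfl⟩
    choose U a hmem hU using exists_opens_comp_eq_section q φ hφ hsplit (z ≫ j) g w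
    have hcov : TopologicalSpace.IsOpenCover U := by
      refine TopologicalSpace.IsOpenCover.mk (top_le_iff.mp fun t _ => ?_)
      exact TopologicalSpace.Opens.mem_iSup.mpr ⟨t, hmem t⟩
    refine ⟨T.openCoverOfIsOpenCover U hcov, fun t => ⟨a t, ?_, hU t⟩⟩
    -- at the point `t` of the member `U t`: `φ (a t) (g t) = j (z t) ∈ range j`
    have hpt : (φ (a t)) (g t) ∈ Set.range j := by
      have h : ((U t).ι ≫ z ≫ j) ⟨t, hmem t⟩ = ((U t).ι ≫ g ≫ φ (a t)) ⟨t, hmem t⟩ := by rw [hU t]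
      simp only [Scheme.Hom.comp_apply, Scheme.Opens.ι_apply] at h
      exact ⟨z t, h⟩
    exact exists_fac_of_apply_mem_range j hcl (φ (a t)) hpt
  · rintro ⟨𝒱, h𝒱⟩
    have hrange : Set.range x ⊆ Set.range j := by
      rintro _ ⟨t, rfl⟩
      obtain ⟨s, hs⟩ := 𝒱.covers t
      obtain ⟨a, ⟨ψ, hψ⟩, ha⟩ := h𝒱 (𝒱.idx t)
      have h : (𝒱.f (𝒱.idx t) ≫ x) s = (𝒱.f (𝒱.idx t) ≫ g ≫ ψ ≫ j) s := by rw [ha, ← hψ]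
      simp only [Scheme.Hom.comp_apply, hs] at h
      exact ⟨_, h.symm⟩
    exact ⟨IsOpenImmersion.lift j x hrange, IsOpenImmersion.lift_fac _ _ _⟩

/-- **Relative form over a preconnected OPEN `U ⊆ S`** (no connectedness of `S`): for `T`-points `x` of `F` whose
structure map `g : T ⟶ S` factors through `U` (`g = gU ≫ U.ι`), `x` factors through `Z` iff, locally on `T`, `x = g ≫ φ a`
with `a ∈ I_Z^U := {a | (φ a)|_U factors through j}` — §2 is applied on the preconnected `↥U` instead of `S`.  This is the
form used on the connected components of a disconnected base (e.g. the level-basis torsor of letter (Ma0)).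
[cite: GortzWedhorn2023, Prop. 27.188 (1) (p. 675)] [cite: GortzWedhorn2020, Def./Prop. 9.7] -/
theorem exists_fac_iff_exists_openCover_of_split_on_opens [FormallyUnramified q] [LocallyOfFiniteType q] [IsSeparated q]
    [IsClosedImmersion j] {qZ : Z ⟶ S} [Etale qZ] (wZ : j ≫ q = qZ) (U : S.Opens) [PreconnectedSpace U]
    {T : Scheme.{u}} (x : T ⟶ F) (gU : T ⟶ U) (w : x ≫ q = gU ≫ U.ι) :
    (∃ z : T ⟶ Z, z ≫ j = x) ↔
      ∃ 𝒱 : Scheme.OpenCover.{u} T, ∀ i, ∃ a, (∃ ψ : (U : Scheme.{u}) ⟶ Z, ψ ≫ j = U.ι ≫ φ a) ∧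
        𝒱.f i ≫ x = 𝒱.f i ≫ (gU ≫ U.ι) ≫ φ a := by
  haveI := isOpenImmersion_of_isClosedImmersion_of_etale j q wZ
  have hcl : IsClosed (Set.range j) := j.isClosedEmbedding.isClosed_range
  constructor
  · rintro ⟨z, rfl⟩
    choose V a hmem hV using exists_opens_comp_eq_section q φ hφ hsplit (z ≫ j) (gU ≫ U.ι) w
    have hcov : TopologicalSpace.IsOpenCover V := by
      refine TopologicalSpace.IsOpenCover.mk (top_le_iff.mp fun t _ => ?_)
      exact TopologicalSpace.Opens.mem_iSup.mpr ⟨t, hmem t⟩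
    refine ⟨T.openCoverOfIsOpenCover V hcov, fun t => ⟨a t, ?_, hV t⟩⟩
    -- at the point `gU t` of `U`: `(U.ι ≫ φ (a t)) (gU t) = j (z t) ∈ range j`
    have hpt : (U.ι ≫ φ (a t)) (gU t) ∈ Set.range j := by
      have h : ((V t).ι ≫ z ≫ j) ⟨t, hmem t⟩ = ((V t).ι ≫ (gU ≫ U.ι) ≫ φ (a t)) ⟨t, hmem t⟩ := by rw [hV t]
      simp only [Scheme.Hom.comp_apply, Scheme.Opens.ι_apply] at h
      rw [Scheme.Hom.comp_apply]
      exact ⟨z t, h⟩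
    exact exists_fac_of_apply_mem_range j hcl (U.ι ≫ φ (a t)) hpt
  · rintro ⟨𝒱, h𝒱⟩
    have hrange : Set.range x ⊆ Set.range j := by
      rintro _ ⟨t, rfl⟩
      obtain ⟨s, hs⟩ := 𝒱.covers t
      obtain ⟨a, ⟨ψ, hψ⟩, ha⟩ := h𝒱 (𝒱.idx t)
      have h : (𝒱.f (𝒱.idx t) ≫ x) s = (𝒱.f (𝒱.idx t) ≫ gU ≫ ψ ≫ j) s := by
        rw [ha, hψ]; simp only [Category.assoc]
      simp only [Scheme.Hom.comp_apply, hs] at h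
      exact ⟨_, h.symm⟩
    exact ⟨IsOpenImmersion.lift j x hrange, IsOpenImmersion.lift_fac _ _ _⟩

end SubschemeOfSplit

/-! ## §5 Gluing two morphisms / two sections along a clopen decomposition of the source -/

section Glue

variable {T Y : Scheme.{u}}

/-- **Gluing along a clopen decomposition**: for opens `U, U'` of `T` with `U' = T ∖ U` (so both are clopen) and two
morphisms `f₁ f₂ : T ⟶ Y` there is `f : T ⟶ Y` equal to `f₁` on `U` and to `f₂` on `U'` — gluing of morphisms on the
two-member open cover `{U, U'}` whose overlap is empty ([GortzWedhorn2020] Prop. 3.5; Mathlib `Scheme.Cover.glueMorphisms`).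
[cite: GortzWedhorn2020, Prop. 3.5] -/
theorem exists_glue_of_isCompl (U U' : T.Opens) (hU : (U' : Set T) = (U : Set T)ᶜ) (f₁ f₂ : T ⟶ Y) :
    ∃ f : T ⟶ Y, U.ι ≫ f = U.ι ≫ f₁ ∧ U'.ι ≫ f = U'.ι ≫ f₂ := by
  classical
  let V : Bool → T.Opens := fun b => cond b U U'
  have hV : TopologicalSpace.IsOpenCover V := by
    refine TopologicalSpace.IsOpenCover.mk (top_le_iff.mp fun t _ => ?_)
    rw [TopologicalSpace.Opens.mem_iSup]
    by_cases ht : t ∈ U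
    · exact ⟨true, ht⟩
    · refine ⟨false, ?_⟩
      change t ∈ (U' : Set T)
      rw [hU]; exact ht
  let 𝒱 : Scheme.OpenCover.{0} T := T.openCoverOfIsOpenCover V hV
  let fs : ∀ b : Bool, (𝒱.X b) ⟶ Y := fun b => match b with
    | true => 𝒱.f true ≫ f₁
    | false => 𝒱.f false ≫ f₂
  -- on overlaps: `U ∩ U' = ∅`, and on the diagonal overlaps the condition is `pullback.condition`
  have hfs : ∀ b c : Bool, pullback.fst (𝒱.f b) (𝒱.f c) ≫ fs b = pullback.snd (𝒱.f b) (𝒱.f c) ≫ fs c := by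
    intro b c
    by_cases hbc : b = c
    · subst hbc
      cases b
      · change pullback.fst (𝒱.f false) (𝒱.f false) ≫ 𝒱.f false ≫ f₂ = pullback.snd (𝒱.f false) (𝒱.f false) ≫ 𝒱.f false ≫ f₂
        rw [pullback.condition_assoc]
      · change pullback.fst (𝒱.f true) (𝒱.f true) ≫ 𝒱.f true ≫ f₁ = pullback.snd (𝒱.f true) (𝒱.f true) ≫ 𝒱.f true ≫ f₁
        rw [pullback.condition_assoc]
    · -- the overlap of `U` and `U'` is empty
      have hmem : ∀ (d : Bool) (p : ↥(𝒱.X d)), (𝒱.f d) p ∈ (V d : Set T) := fun d p => by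
        change (V d).ι p ∈ (V d : Set T)
        rw [Scheme.Opens.ι_apply]; exact Subtype.property _
      have hem : IsEmpty ↥(pullback (𝒱.f b) (𝒱.f c)) := by
        refine ⟨fun p => ?_⟩
        have h1 : (𝒱.f b) (pullback.fst (𝒱.f b) (𝒱.f c) p) = (𝒱.f c) (pullback.snd (𝒱.f b) (𝒱.f c) p) := by
          rw [← Scheme.Hom.comp_apply, ← Scheme.Hom.comp_apply, pullback.condition]
        have hb := hmem b (pullback.fst (𝒱.f b) (𝒱.f c) p)
        have hc := hmem c (pullback.snd (𝒱.f b) (𝒱.f c) p)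
        rw [h1] at hb
        revert hbc hb hc
        cases b <;> cases c <;> intro hbc hb hc
        · exact hbc rfl
        · change _ ∈ (U' : Set T) at hb; change _ ∈ (U : Set T) at hc
          rw [hU] at hb; exact hb hc
        · change _ ∈ (U : Set T) at hb; change _ ∈ (U' : Set T) at hc
          rw [hU] at hc; exact hc hb
        · exact hbc rfl
      exact (isInitialOfIsEmpty (X := pullback (𝒱.f b) (𝒱.f c))).hom_ext _ _
  refine ⟨Scheme.Cover.glueMorphisms 𝒱 fs hfs, ?_, ?_⟩
  · exact Scheme.Cover.ι_glueMorphisms 𝒱 fs hfs true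
  · exact Scheme.Cover.ι_glueMorphisms 𝒱 fs hfs false

/-- **Gluing two SECTIONS along a clopen decomposition**: for `q : Y ⟶ T`, opens `U, U' = T ∖ U` and sections `σ₁ σ₂`
of `q` there is a section `σ` of `q` equal to `σ₁` on `U` and to `σ₂` on `U'` (the glued morphism is again a section:
check on the cover, Mathlib `Scheme.Cover.hom_ext`).  Used with `σ₂ :=` the unit section to extend a section given on
one connected component of the (disconnected) level-basis cover. [cite: GortzWedhorn2020, Prop. 3.5] -/
theorem exists_section_glue_of_isCompl (q : Y ⟶ T) (U U' : T.Opens) (hU : (U' : Set T) = (U : Set T)ᶜ)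
    (σ₁ σ₂ : T ⟶ Y) (h₁ : σ₁ ≫ q = 𝟙 T) (h₂ : σ₂ ≫ q = 𝟙 T) :
    ∃ σ : T ⟶ Y, σ ≫ q = 𝟙 T ∧ U.ι ≫ σ = U.ι ≫ σ₁ ∧ U'.ι ≫ σ = U'.ι ≫ σ₂ := by
  classical
  obtain ⟨σ, hσ₁, hσ₂⟩ := exists_glue_of_isCompl U U' hU σ₁ σ₂
  refine ⟨σ, ?_, hσ₁, hσ₂⟩
  let V : Bool → T.Opens := fun b => cond b U U'
  have hV : TopologicalSpace.IsOpenCover V := by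
    refine TopologicalSpace.IsOpenCover.mk (top_le_iff.mp fun t _ => ?_)
    rw [TopologicalSpace.Opens.mem_iSup]
    by_cases ht : t ∈ U
    · exact ⟨true, ht⟩
    · refine ⟨false, ?_⟩
      change t ∈ (U' : Set T)
      rw [hU]; exact ht
  refine Scheme.Cover.hom_ext (T.openCoverOfIsOpenCover V hV) _ _ fun b => ?_
  cases b
  · change U'.ι ≫ σ ≫ q = U'.ι ≫ 𝟙 T
    rw [← Category.assoc, hσ₂, Category.assoc, h₂]
  · change U.ι ≫ σ ≫ q = U.ι ≫ 𝟙 T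
    rw [← Category.assoc, hσ₁, Category.assoc, h₁]

/-- **Gluing along a clopen PARTITION** (any index type): for pairwise disjoint opens `U k` covering `T` (so each is
clopen) and morphisms `f k : T ⟶ Y` there is `F : T ⟶ Y` equal to `f k` on `U k` — Mathlib `Scheme.Cover.glueMorphisms` on
the cover `(U k)`, whose overlaps are empty off the diagonal. [cite: GortzWedhorn2020, Prop. 3.5] -/
theorem exists_glue_of_pairwise_disjoint {κ : Type*} (U : κ → T.Opens) (hU : TopologicalSpace.IsOpenCover U)
    (hdisj : ∀ k k', k ≠ k' → Disjoint (U k : Set T) (U k')) (f : κ → (T ⟶ Y)) :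
    ∃ F : T ⟶ Y, ∀ k, (U k).ι ≫ F = (U k).ι ≫ f k := by
  classical
  let 𝒱 := T.openCoverOfIsOpenCover U hU
  let fs : ∀ k, (𝒱.X k) ⟶ Y := fun k => 𝒱.f k ≫ f k
  have hmem : ∀ (k) (p : ↥(𝒱.X k)), (𝒱.f k) p ∈ (U k : Set T) := fun k p => by
    change (U k).ι p ∈ (U k : Set T)
    rw [Scheme.Opens.ι_apply]; exact Subtype.property _
  have hfs : ∀ k k', pullback.fst (𝒱.f k) (𝒱.f k') ≫ fs k = pullback.snd (𝒱.f k) (𝒱.f k') ≫ fs k' := by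
    intro k k'
    by_cases hkk : k = k'
    · subst hkk
      change pullback.fst (𝒱.f k) (𝒱.f k) ≫ 𝒱.f k ≫ f k = pullback.snd (𝒱.f k) (𝒱.f k) ≫ 𝒱.f k ≫ f k
      rw [pullback.condition_assoc]
    · have hem : IsEmpty ↥(pullback (𝒱.f k) (𝒱.f k')) := by
        refine ⟨fun p => ?_⟩
        have h1 : (𝒱.f k) (pullback.fst (𝒱.f k) (𝒱.f k') p) = (𝒱.f k') (pullback.snd (𝒱.f k) (𝒱.f k') p) := by
          rw [← Scheme.Hom.comp_apply, ← Scheme.Hom.comp_apply, pullback.condition]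
        have hb := hmem k (pullback.fst (𝒱.f k) (𝒱.f k') p)
        have hc := hmem k' (pullback.snd (𝒱.f k) (𝒱.f k') p)
        rw [h1] at hb
        exact Set.disjoint_left.mp (hdisj k k' hkk) hb hc
      exact (isInitialOfIsEmpty (X := pullback (𝒱.f k) (𝒱.f k'))).hom_ext _ _
  exact ⟨Scheme.Cover.glueMorphisms 𝒱 fs hfs, fun k => Scheme.Cover.ι_glueMorphisms 𝒱 fs hfs k⟩

/-- **Gluing LOCAL data along a clopen partition**: morphisms `f k : U k ⟶ Y` given on the members of a clopen
partition of `T` glue to `F : T ⟶ Y` with `(U k).ι ≫ F = f k`. [cite: GortzWedhorn2020, Prop. 3.5] -/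
theorem exists_glue_local_of_pairwise_disjoint {κ : Type*} (U : κ → T.Opens) (hU : TopologicalSpace.IsOpenCover U)
    (hdisj : ∀ k k', k ≠ k' → Disjoint (U k : Set T) (U k')) (f : ∀ k, (U k : Scheme.{u}) ⟶ Y) :
    ∃ F : T ⟶ Y, ∀ k, (U k).ι ≫ F = f k := by
  classical
  let 𝒱 := T.openCoverOfIsOpenCover U hU
  have hmem : ∀ (k) (p : ↥(𝒱.X k)), (𝒱.f k) p ∈ (U k : Set T) := fun k p => by
    change (U k).ι p ∈ (U k : Set T)
    rw [Scheme.Opens.ι_apply]; exact Subtype.property _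
  have hfs : ∀ k k', pullback.fst (𝒱.f k) (𝒱.f k') ≫ f k = pullback.snd (𝒱.f k) (𝒱.f k') ≫ f k' := by
    intro k k'
    by_cases hkk : k = k'
    · subst hkk
      -- the two projections of the self-overlap of the monomorphism `(U k).ι` agree
      have : pullback.fst (𝒱.f k) (𝒱.f k) = pullback.snd (𝒱.f k) (𝒱.f k) := by
        rw [← cancel_mono (𝒱.f k)]; exact pullback.condition
      rw [this]
    · have hem : IsEmpty ↥(pullback (𝒱.f k) (𝒱.f k')) := by
        refine ⟨fun p => ?_⟩
        have h1 : (𝒱.f k) (pullback.fst (𝒱.f k) (𝒱.f k') p) = (𝒱.f k') (pullback.snd (𝒱.f k) (𝒱.f k') p) := by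
          rw [← Scheme.Hom.comp_apply, ← Scheme.Hom.comp_apply, pullback.condition]
        have hb := hmem k (pullback.fst (𝒱.f k) (𝒱.f k') p)
        have hc := hmem k' (pullback.snd (𝒱.f k) (𝒱.f k') p)
        rw [h1] at hb
        exact Set.disjoint_left.mp (hdisj k k' hkk) hb hc
      exact (isInitialOfIsEmpty (X := pullback (𝒱.f k) (𝒱.f k'))).hom_ext _ _
  exact ⟨Scheme.Cover.glueMorphisms 𝒱 f hfs, fun k => Scheme.Cover.ι_glueMorphisms 𝒱 f hfs k⟩

/-- **Gluing SECTIONS along a clopen partition**: sections `σ k` of `q : Y ⟶ T` given on the members of a clopen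
partition glue to a section. [cite: GortzWedhorn2020, Prop. 3.5] -/
theorem exists_section_glue_of_pairwise_disjoint (q : Y ⟶ T) {κ : Type*} (U : κ → T.Opens)
    (hU : TopologicalSpace.IsOpenCover U) (hdisj : ∀ k k', k ≠ k' → Disjoint (U k : Set T) (U k'))
    (σ : κ → (T ⟶ Y)) (hσ : ∀ k, σ k ≫ q = 𝟙 T) :
    ∃ τ : T ⟶ Y, τ ≫ q = 𝟙 T ∧ ∀ k, (U k).ι ≫ τ = (U k).ι ≫ σ k := by
  classical
  obtain ⟨τ, hτ⟩ := exists_glue_of_pairwise_disjoint U hU hdisj σ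
  refine ⟨τ, ?_, hτ⟩
  refine Scheme.Cover.hom_ext (T.openCoverOfIsOpenCover U hU) _ _ fun k => ?_
  change (U k).ι ≫ τ ≫ q = (U k).ι ≫ 𝟙 T
  rw [← Category.assoc, hτ k, Category.assoc, hσ k]

end Glue

end Literature.AlgebraicGeometry.Morphisms

end
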